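import Mathlib.Analysis.Calculus.ContDiff.Comp
import Mathlib.Analysis.Calculus.Deriv.MeanValue
import Mathlib.Analysis.Calculus.Deriv.Prod
import HarnessLib

/-!
# Small multiples of Hessian-positive directions lie on the positive side

Helper layer `helper_timelike_posScale` (generic calculus) of stub `helper_foldNF_timelike` (the
untwistedness of the round `1`-handle of a genus-one simplified broken Lefschetz fibration),
line `Sketch`, crux `SblfDescent.RungOne`.

(Crux item stmt-SmoothPoincare4-18531; skeleton `Cruxes/RungOne/Lines/Sketch.lean`.)

Let `g : ℝ × V → ℝ` be `C^∞` with `g (t, 0) = 0` and `dg (t, 0) = 0` along the zero section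
(the height family of an SBLF along a tube about its round circle, `helper_foldNF_family`).  For
a compact set `K` of pairs `(t, x)` with `∂ₓ∂ₓ g (t, 0) (x, x) > 0` (spacelike directions of
the page Hessians) there is a uniform `r₀ > 0` with `g (t, r x) > 0` for all `(t, x) ∈ K` and
`0 < r ≤ r₀` (`helper_timelike_posScale`): the second derivative of `r ↦ g (t, r x)` is
positive near `r = 0` uniformly on `K` (tube lemma), so the first derivative, vanishing at `0`,
is positive for small `r > 0`, and so is the function (Taylor to second order, in monotonicity
form).  This places the small spacelike circles of the page Hessians — the vanishing cycles —
on the higher-genus side of the fold.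

## References

* J. Milnor, *Morse theory* (1963), §2 (Lemma 2.1, Taylor with remainder). [Milnor1963]
-/

set_option linter.dupNamespace false

noncomputable section

open scoped Topology ContDiff
open Set Function Filter Metric

namespace Summit.SmoothPoincare4.SmoothPoincare4.Cruxes.RungOne.Sketch

/-- **Small multiples of Hessian-positive directions lie on the positive side, uniformly on
compact sets.**  Let `g : ℝ × V → ℝ` be `C^∞` with `g (t, 0) = 0` and `dg (t, 0) = 0` for all
`t`, and `K ⊆ ℝ × V` compact with `∂ₓ∂ₓ g (t, 0) (x, x) > 0` for `(t, x) ∈ K`.  Then there is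
`r₀ > 0` with `g (t, r x) > 0` for all `(t, x) ∈ K` and `0 < r ≤ r₀`.
[cite: Milnor1963, §2, Lemma 2.1] -/
theorem helper_timelike_posScale : ∀ (V : Type) [NormedAddCommGroup V] [NormedSpace ℝ V] (g : ℝ × V → ℝ), ContDiff ℝ ∞ g → (∀ t : ℝ, g (t, 0) = 0) → (∀ t : ℝ, fderiv ℝ g (t, 0) = 0) → ∀ (K : Set (ℝ × V)), IsCompact K → (∀ q ∈ K, 0 < fderiv ℝ (fderiv ℝ g) (q.1, 0) ((0 : ℝ), q.2) ((0 : ℝ), q.2)) → ∃ r₀ : ℝ, 0 < r₀ ∧ ∀ q ∈ K, ∀ r : ℝ, 0 < r → r ≤ r₀ → 0 < g (q.1, r • q.2) := by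
  intro V _ _ g hg hg0 hg1 K hK hpos
  -- the second derivative along the ray, as a continuous function of `(q, ρ)`
  have hD1 : ContDiff ℝ ∞ (fderiv ℝ g) := hg.fderiv_right (m := ∞) le_rfl
  have hD2c : Continuous (fderiv ℝ (fderiv ℝ g)) := (hD1.fderiv_right (m := ∞) le_rfl).continuous
  set Ψ : (ℝ × V) × ℝ → ℝ := fun p =>
    fderiv ℝ (fderiv ℝ g) (p.1.1, p.2 • p.1.2) ((0 : ℝ), p.1.2) ((0 : ℝ), p.1.2) with hΨ
  have hray : Continuous fun p : (ℝ × V) × ℝ => ((p.1.1, p.2 • p.1.2) : ℝ × V) :=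
    (continuous_fst.comp continuous_fst).prodMk (continuous_snd.smul (continuous_snd.comp continuous_fst))
  have hdir : Continuous fun p : (ℝ × V) × ℝ => (((0 : ℝ), p.1.2) : ℝ × V) :=
    continuous_const.prodMk (continuous_snd.comp continuous_fst)
  have hΨc : Continuous Ψ := ((hD2c.comp hray).clm_apply hdir).clm_apply hdir
  -- positivity on `K × {0}`, hence on `u × (-ε, ε)` for an open `u ⊇ K`
  set O : Set ((ℝ × V) × ℝ) := Ψ ⁻¹' Ioi 0 with hO
  have hOo : IsOpen O := isOpen_Ioi.preimage hΨc
  have hsub : K ×ˢ ({(0 : ℝ)} : Set ℝ) ⊆ O := by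
    rintro ⟨q, ρ⟩ ⟨hq, hρ⟩
    rw [mem_singleton_iff] at hρ
    subst hρ
    change 0 < fderiv ℝ (fderiv ℝ g) (q.1, (0 : ℝ) • q.2) ((0 : ℝ), q.2) ((0 : ℝ), q.2)
    rw [zero_smul]
    exact hpos q hq
  obtain ⟨u, w, -, hw, hKu, h0w, huw⟩ := generalized_tube_lemma hK isCompact_singleton hOo hsub
  obtain ⟨ε, hε, hball⟩ := Metric.isOpen_iff.1 hw 0 (h0w rfl)
  refine ⟨ε / 2, by positivity, fun q hq r hr hrε => ?_⟩
  have hΨpos : ∀ ρ : ℝ, 0 ≤ ρ → ρ < ε → 0 < Ψ (q, ρ) := fun ρ h0 h1 => by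
    have : (q, ρ) ∈ O := huw ⟨hKu hq, hball (by rw [Real.ball_eq_Ioo]; exact ⟨by linarith, by linarith⟩)⟩
    exact this
  -- the ray functions `φ ρ = g (t, ρ x)` and `φ₁ ρ = dg (t, ρ x) (0, x)`
  set φ : ℝ → ℝ := fun ρ => g (q.1, ρ • q.2) with hφ
  set φ₁ : ℝ → ℝ := fun ρ => fderiv ℝ g (q.1, ρ • q.2) ((0 : ℝ), q.2) with hφ₁
  have hc : ∀ ρ : ℝ, HasDerivAt (fun ρ : ℝ => ((q.1, ρ • q.2) : ℝ × V)) (((0 : ℝ), q.2) : ℝ × V) ρ :=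
    fun ρ => by
      have h := (hasDerivAt_const ρ q.1).prodMk ((hasDerivAt_id ρ).smul_const q.2)
      simp only [one_smul] at h
      exact h
  have hφd : ∀ ρ, HasDerivAt φ (φ₁ ρ) ρ := fun ρ =>
    ((hg.differentiable (by simp)) _).hasFDerivAt.comp_hasDerivAt ρ (hc ρ)
  have hφ₁d : ∀ ρ, HasDerivAt φ₁ (Ψ (q, ρ)) ρ := fun ρ => by
    have h1 : HasDerivAt (fun ρ : ℝ => fderiv ℝ g ((q.1, ρ • q.2) : ℝ × V))
        (fderiv ℝ (fderiv ℝ g) (q.1, ρ • q.2) (((0 : ℝ), q.2) : ℝ × V)) ρ :=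
      ((hD1.differentiable (by simp)) _).hasFDerivAt.comp_hasDerivAt ρ (hc ρ)
    have h2 := h1.clm_apply (hasDerivAt_const ρ (((0 : ℝ), q.2) : ℝ × V))
    simpa [hΨ] using h2
  have hφ0 : φ 0 = 0 := by simp [hφ, hg0]
  have hφ₁0 : φ₁ 0 = 0 := by simp [hφ₁, hg1]
  -- `φ₁` increases strictly on `[0, ε/2]`, so it is positive on `(0, ε/2]`
  have hφ₁mono : StrictMonoOn φ₁ (Icc 0 (ε / 2)) := by
    refine strictMonoOn_of_deriv_pos (convex_Icc 0 (ε / 2))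
      (fun ρ _ => (hφ₁d ρ).continuousAt.continuousWithinAt) fun ρ hρ => ?_
    rw [interior_Icc] at hρ
    rw [(hφ₁d ρ).deriv]
    exact hΨpos ρ hρ.1.le (by linarith [hρ.2])
  have hφ₁pos : ∀ ρ, 0 < ρ → ρ ≤ ε / 2 → 0 < φ₁ ρ := fun ρ h0 h1 => by
    have := hφ₁mono ⟨le_rfl, by positivity⟩ ⟨h0.le, h1⟩ h0
    rwa [hφ₁0] at this
  -- hence `φ` increases strictly on `[0, r]` and `φ r > φ 0 = 0`
  have hφmono : StrictMonoOn φ (Icc 0 r) := by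
    refine strictMonoOn_of_deriv_pos (convex_Icc 0 r)
      (fun ρ _ => (hφd ρ).continuousAt.continuousWithinAt) fun ρ hρ => ?_
    rw [interior_Icc] at hρ
    rw [(hφd ρ).deriv]
    exact hφ₁pos ρ hρ.1 (by linarith [hρ.2])
  have := hφmono ⟨le_rfl, hr.le⟩ ⟨hr.le, le_rfl⟩ hr
  rwa [hφ0] at this

end Summit.SmoothPoincare4.SmoothPoincare4.Cruxes.RungOne.Sketch

end
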